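import Literature.Analysis.FluidPDE.CurlIsometryCovariance
import Literature.Analysis.FluidPDE.AxisymNoSwirlVorticity
import Literature.Analysis.FluidPDE.FlatSwirlGauge
import HarnessLib

/-!
# The helicity density `v · curl v` is a pseudoscalar under rigid motions, and vanishes for
# axisymmetric swirl-free fields

Topic `Literature/Analysis/FluidPDE` (companion of `CurlIsometryCovariance.lean`, which proves the
pseudovector law `curl (R ∘ v ∘ R⁻¹)(x) = det R • R (curl v (R⁻¹ x))`, `det R = ±1`, for a linear
isometry `R` of `ℝ³ = EuclideanSpace ℝ (Fin 3)`). Everything here is proved; no definitions, no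
named facts.

* `curl_conj_rigidMotion`: the same law for the rigid motion `y ↦ R⁻¹ y + c`, i.e. for the field
  `y ↦ R (v (R⁻¹ y + c))` (the curl commutes with translations, `curl_comp_add_const`).
* `inner_self_curl_conj_linearIsometryEquiv`, `inner_self_curl_conj_rigidMotion`: the **helicity
  density** `h_v (x) = ⟪v x, curl v x⟫` (Moffatt 1969) is a PSEUDOSCALAR:
  `h_{R v(R⁻¹ · + c)} (x) = det R · h_v (R⁻¹ x + c)` (Arfken–Weber §2.9: the contraction of a polar
  vector with an axial vector is a pseudoscalar); hence `… = 0 ↔ h_v (R⁻¹ x + c) = 0` and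
  `|…| = |h_v (R⁻¹ x + c)|`.
* `inner_self_curl_eq_zero_of_isAxisymmetric`: for a `C¹` field which is axisymmetric (about the
  `x₃`-axis) and swirl free, `⟪v x, curl v x⟫ = 0` at EVERY point: the velocity is poloidal
  (`v = vʳ e_r + v³ e₃`) and the vorticity is toroidal (`ω = ω^θ e_θ`, Majda–Bertozzi (2.53)–(2.54);
  in the tree `inner_curl_horizontal_eq_zero` = `ω_r = 0` and `curl_apply_two_eq_zero` = `ω_z = 0`),
  so they are pointwise orthogonal; on the axis by continuity.
* `inner_self_curl_eq_zero_of_conj_rigidMotion`: consequently, if SOME rigid placement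
  `y ↦ R (v (R⁻¹ y + c))` of a `C¹` field `v` is axisymmetric and swirl free, the helicity density of
  `v` itself vanishes identically; contrapositive
  `not_isAxisymmetric_and_hasNoSwirl_conj_of_inner_self_curl_ne_zero`: a single point of non-zero
  helicity density certifies that `v` is axisymmetric-swirl-free in NO placement.

WHAT THIS IS NOT: no statement about fields with vanishing helicity density (they need not be
axisymmetric: every planar flow has `v · curl v ≡ 0`), and nothing about total helicity `∫ v · ω`.

## References

* H. K. Moffatt, *The degree of knottedness of tangled vortex lines*, J. Fluid Mech. 35 (1969)
  117–129, §1 (the helicity density `u · ω` and its pseudoscalar character). [Moffatt1969]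
* G. B. Arfken, H.-J. Weber, *Mathematical Methods for Physicists*, 4th ed. (1995), §2.9
  (pseudoscalars, pseudovectors; eq. (2.90)). [ArfkenWeber1995]
* A. J. Majda, A. L. Bertozzi, *Vorticity and Incompressible Flow* (CUP 2002), §2.3.3,
  eqs. (2.53)–(2.54) (axisymmetric flow without swirl: `v = vʳ e_r + v³ e₃`, `ω = ω^θ e_θ`).
  [MajdaBertozziCUP2002]
-/

noncomputable section

open scoped InnerProductSpace RealInnerProductSpace

namespace Literature.Analysis.FluidPDE

/-! ### The helicity density is a pseudoscalar under rigid motions -/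

section Pseudoscalar

variable (R : EuclideanSpace ℝ (Fin 3) ≃ₗᵢ[ℝ] EuclideanSpace ℝ (Fin 3))

/-- **Covariance of the curl under rigid motions**: for a linear isometry `R` of `ℝ³`, a translation
`c`, a field `v` and every `x`, `curl (y ↦ R (v (R⁻¹ y + c))) (x) = det R • R (curl v (R⁻¹ x + c))`
(the pseudovector law `curl_conj_linearIsometryEquiv` composed with translation covariance
`curl_comp_add_const`; no differentiability hypothesis — both sides are junk together).
[cite: ArfkenWeber1995, §2.9 eq. (2.90), (2.97)–(2.99)] -/
theorem curl_conj_rigidMotion (c : EuclideanSpace ℝ (Fin 3))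
    (v : EuclideanSpace ℝ (Fin 3) → EuclideanSpace ℝ (Fin 3)) (x : EuclideanSpace ℝ (Fin 3)) :
    curl (fun y => R (v (R.symm y + c))) x =
      (R : EuclideanSpace ℝ (Fin 3) →L[ℝ] EuclideanSpace ℝ (Fin 3)).det •
        R (curl v (R.symm x + c)) := by
  rw [← curl_comp_add_const v c (R.symm x)]
  exact curl_conj_linearIsometryEquiv R (fun z => v (z + c)) x

/-- **The helicity density is a pseudoscalar (linear isometries)**: with `h_v (x) = ⟪v x, curl v x⟫`,
`h_{R v R⁻¹} (x) = det R · h_v (R⁻¹ x)` — the contraction of the (polar) velocity with the (axial)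
vorticity changes sign under reflections (Moffatt 1969 §1; Arfken–Weber §2.9).
[cite: ArfkenWeber1995, §2.9 eq. (2.90)] -/
theorem inner_self_curl_conj_linearIsometryEquiv
    (v : EuclideanSpace ℝ (Fin 3) → EuclideanSpace ℝ (Fin 3)) (x : EuclideanSpace ℝ (Fin 3)) :
    ⟪R (v (R.symm x)), curl (fun y => R (v (R.symm y))) x⟫ =
      (R : EuclideanSpace ℝ (Fin 3) →L[ℝ] EuclideanSpace ℝ (Fin 3)).det *
        ⟪v (R.symm x), curl v (R.symm x)⟫ := by
  rw [curl_conj_linearIsometryEquiv, inner_smul_right, LinearIsometryEquiv.inner_map_map]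

/-- **The helicity density is a pseudoscalar (rigid motions)**:
`h_{R v(R⁻¹ · + c)} (x) = det R · h_v (R⁻¹ x + c)`. [cite: ArfkenWeber1995, §2.9 eq. (2.90)] -/
theorem inner_self_curl_conj_rigidMotion (c : EuclideanSpace ℝ (Fin 3))
    (v : EuclideanSpace ℝ (Fin 3) → EuclideanSpace ℝ (Fin 3)) (x : EuclideanSpace ℝ (Fin 3)) :
    ⟪R (v (R.symm x + c)), curl (fun y => R (v (R.symm y + c))) x⟫ =
      (R : EuclideanSpace ℝ (Fin 3) →L[ℝ] EuclideanSpace ℝ (Fin 3)).det *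
        ⟪v (R.symm x + c), curl v (R.symm x + c)⟫ := by
  rw [curl_conj_rigidMotion, inner_smul_right, LinearIsometryEquiv.inner_map_map]

/-- The helicity density of a rigidly moved field vanishes at `x` iff that of the original field
vanishes at the corresponding point `R⁻¹ x + c` (`det R = ±1`). [cite: ArfkenWeber1995, §2.9 eq. (2.90)] -/
theorem inner_self_curl_conj_rigidMotion_eq_zero_iff (c : EuclideanSpace ℝ (Fin 3))
    (v : EuclideanSpace ℝ (Fin 3) → EuclideanSpace ℝ (Fin 3)) (x : EuclideanSpace ℝ (Fin 3)) :
    ⟪R (v (R.symm x + c)), curl (fun y => R (v (R.symm y + c))) x⟫ = 0 ↔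
      ⟪v (R.symm x + c), curl v (R.symm x + c)⟫ = 0 := by
  rw [inner_self_curl_conj_rigidMotion, mul_eq_zero, or_iff_right]
  rcases det_linearIsometryEquiv_eq_one_or_eq_neg_one R with h | h <;> rw [h] <;> norm_num

/-- The absolute helicity density is invariant under rigid motions:
`|h_{R v(R⁻¹ · + c)} (x)| = |h_v (R⁻¹ x + c)|`. [cite: ArfkenWeber1995, §2.9 eq. (2.90)] -/
theorem abs_inner_self_curl_conj_rigidMotion (c : EuclideanSpace ℝ (Fin 3))
    (v : EuclideanSpace ℝ (Fin 3) → EuclideanSpace ℝ (Fin 3)) (x : EuclideanSpace ℝ (Fin 3)) :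
    |⟪R (v (R.symm x + c)), curl (fun y => R (v (R.symm y + c))) x⟫| =
      |⟪v (R.symm x + c), curl v (R.symm x + c)⟫| := by
  rw [inner_self_curl_conj_rigidMotion, abs_mul]
  rcases det_linearIsometryEquiv_eq_one_or_eq_neg_one R with h | h <;> rw [h] <;> simp

/-- A rigidly moved `Cⁿ` field is `Cⁿ` (chain rule; the rigid motions `y ↦ R⁻¹ y + c` are the
translation and rotation symmetries of Majda–Bertozzi, Prop. 1.1 (ii)–(iii)).
[cite: MajdaBertozziCUP2002, §1.2 Prop. 1.1 (ii)–(iii)] -/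
theorem ContDiff.conj_rigidMotion {n : WithTop ℕ∞} (c : EuclideanSpace ℝ (Fin 3))
    {v : EuclideanSpace ℝ (Fin 3) → EuclideanSpace ℝ (Fin 3)} (hv : ContDiff ℝ n v) :
    ContDiff ℝ n (fun y => R (v (R.symm y + c))) :=
  R.toContinuousLinearEquiv.contDiff.comp
    (hv.comp ((R.symm.toContinuousLinearEquiv.contDiff).add contDiff_const))

end Pseudoscalar

/-! ### Axisymmetric swirl-free fields have zero helicity density -/

section AxisymNoSwirl

variable {v : EuclideanSpace ℝ (Fin 3) → EuclideanSpace ℝ (Fin 3)}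

/-- The helicity density in coordinates: `⟪v x, curl v x⟫ = Σᵢ vᵢ ωᵢ` (helper). [folklore] -/
private theorem inner_self_curl_eq_sum (v : EuclideanSpace ℝ (Fin 3) → EuclideanSpace ℝ (Fin 3))
    (x : EuclideanSpace ℝ (Fin 3)) :
    ⟪v x, curl v x⟫ = v x 0 * curl v x 0 + v x 1 * curl v x 1 + v x 2 * curl v x 2 := by
  simp only [PiLp.inner_apply, RCLike.inner_apply, conj_trivial, Fin.sum_univ_three]
  ring

/-- **Axisymmetric swirl-free fields have zero helicity density** (Majda–Bertozzi §2.3.3: for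
`v = vʳ e_r + v³ e₃` the vorticity is `ω = ω^θ e_θ`, (2.53)–(2.54), so `v · ω = 0`): for `v ∈ C¹`
axisymmetric about the `x₃`-axis and swirl free, `⟪v x, curl v x⟫ = 0` for EVERY `x`. Off the plane
`{x₀ = 0}` this is the algebra `(x₀² + x₁²)(v₀ω₀ + v₁ω₁) = (x₀v₀ + x₁v₁)(x₀ω₀ + x₁ω₁) +
(x₀ω₁ − x₁ω₀)(x₀v₁ − x₁v₀)` with `ω_r = 0` (`inner_curl_horizontal_eq_zero`), `Γ = 0` and `ω_z = 0`
(`curl_apply_two_eq_zero`); on the plane by continuity. [cite: MajdaBertozziCUP2002, §2.3.3 eqs. (2.53)–(2.54)] -/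
theorem inner_self_curl_eq_zero_of_isAxisymmetric (hax : IsAxisymmetric v) (hsw : HasNoSwirl v)
    (hv : ContDiff ℝ 1 v) (x : EuclideanSpace ℝ (Fin 3)) : ⟪v x, curl v x⟫ = 0 := by
  have hd : ∀ y, DifferentiableAt ℝ v y := fun y => (hv.differentiable one_ne_zero) y
  -- off the plane `{y₀ = 0}`
  have hoff : ∀ y : EuclideanSpace ℝ (Fin 3), y 0 ≠ 0 → ⟪v y, curl v y⟫ = 0 := by
    intro y hy0
    have hrad := inner_curl_horizontal_eq_zero hax hsw (hd y)
    have h2 := curl_apply_two_eq_zero hax hsw hv y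
    have hs : y 0 * v y 1 - y 1 * v y 0 = 0 := hsw y
    have key : (y 0 ^ 2 + y 1 ^ 2) * ⟪v y, curl v y⟫ = 0 := by
      rw [inner_self_curl_eq_sum, h2]
      linear_combination (y 0 * v y 0 + y 1 * v y 1) * hrad +
        (y 0 * curl v y 1 - y 1 * curl v y 0) * hs
    have hpos : 0 < y 0 ^ 2 + y 1 ^ 2 := by positivity
    exact (mul_eq_zero.1 key).resolve_left hpos.ne'
  -- on the plane, by continuity along `x + s e₀`
  have hcont : Continuous fun y => ⟪v y, curl v y⟫ :=
    hv.continuous.inner (continuous_curl hv)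
  by_cases hx : x 0 = 0
  · refine eq_zero_of_continuous_of_forall_line hcont x (EuclideanSpace.single 0 1) fun s hs => ?_
    exact hoff _ (by simp [hx, hs])
  · exact hoff x hx

/-- **Zero helicity density in every placement**: if some rigid placement `y ↦ R (v (R⁻¹ y + c))` of
a `C¹` field `v` is axisymmetric (about the `x₃`-axis) and swirl free — i.e. `v` is axisymmetric
without swirl about the axis `c + R⁻¹(ℝ e₃)` — then `⟪v x, curl v x⟫ = 0` for every `x`
(the helicity density is a pseudoscalar, `inner_self_curl_conj_rigidMotion`).
[cite: MajdaBertozziCUP2002, §2.3.3 eqs. (2.53)–(2.54)] -/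
theorem inner_self_curl_eq_zero_of_conj_rigidMotion
    (R : EuclideanSpace ℝ (Fin 3) ≃ₗᵢ[ℝ] EuclideanSpace ℝ (Fin 3)) (c : EuclideanSpace ℝ (Fin 3))
    (hv : ContDiff ℝ 1 v) (hax : IsAxisymmetric fun y => R (v (R.symm y + c)))
    (hsw : HasNoSwirl fun y => R (v (R.symm y + c))) (x : EuclideanSpace ℝ (Fin 3)) :
    ⟪v x, curl v x⟫ = 0 := by
  have h0 := inner_self_curl_eq_zero_of_isAxisymmetric hax hsw (ContDiff.conj_rigidMotion R c hv) (R (x - c))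
  rw [inner_self_curl_conj_rigidMotion_eq_zero_iff] at h0
  simpa using h0

/-- **A point of non-zero helicity density certifies "axisymmetric-swirl-free in no placement"**:
if `⟪v x, curl v x⟫ ≠ 0` at one point of a `C¹` field `v`, then no rigid placement
`y ↦ R (v (R⁻¹ y + c))` of `v` is both axisymmetric and swirl free.
[cite: MajdaBertozziCUP2002, §2.3.3 eqs. (2.53)–(2.54)] -/
theorem not_isAxisymmetric_and_hasNoSwirl_conj_of_inner_self_curl_ne_zero
    (hv : ContDiff ℝ 1 v) {x : EuclideanSpace ℝ (Fin 3)} (hx : ⟪v x, curl v x⟫ ≠ 0)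
    (R : EuclideanSpace ℝ (Fin 3) ≃ₗᵢ[ℝ] EuclideanSpace ℝ (Fin 3)) (c : EuclideanSpace ℝ (Fin 3)) :
    ¬ (IsAxisymmetric (fun y => R (v (R.symm y + c))) ∧ HasNoSwirl (fun y => R (v (R.symm y + c)))) :=
  fun h => hx (inner_self_curl_eq_zero_of_conj_rigidMotion R c hv h.1 h.2 x)

end AxisymNoSwirl

end Literature.Analysis.FluidPDE
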